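import Literature.Probability.RandomPlanarGeometry.Curve
import Mathlib.Topology.UnitInterval
import Mathlib.Topology.Order.IntermediateValue
import Mathlib.Topology.MetricSpace.Pseudo.Lemmas
import Mathlib.Topology.UniformSpace.HeineCantor
import HarnessLib

/-!
# Monotone reparametrisations of the same arc are at reparametrisation distance zero

A light home (imports `RandomPlanarGeometry/Curve.lean` and Mathlib only) for the perturbation
lemma: two monotone continuous traversals `V ∘ h₁`, `V ∘ h₂` of the same continuous arc
`V : [0, m] → E` have `Curve.reparamDist = 0` (perturb `hᵢ` to the strictly increasing
`(1 - θ) hᵢ + θ m t`, which are order isomorphisms onto `[0, m]`, and use uniform continuity of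
`V`).

## Overlap (for a librarian `refactor:` item)

This is a VERBATIM copy, under the primed name `Curve.reparamDist_eq_zero_of_monotone'`, of
`Literature.Probability.RandomPlanarGeometry.Curve.reparamDist_eq_zero_of_monotone`, which is
declared (with `_root_`) inside `Literature/Probability/Percolation/LoopRotationInvarianceAssembly.lean`
(l. 309), a file that imports the whole DKKMO critical-percolation assembly stack. The UST Peano
curve tooling of this directory (`PolylineArc.lean`, [LSW04] §4.3 approximation bounds) must not
depend on Percolation, hence this copy; the intended refactor is to make the Percolation file import
this one and drop its copy (then the prime can go).
-/

noncomputable section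

open Set

namespace Literature.Probability.RandomPlanarGeometry

namespace Curve

open scoped unitInterval

variable {E : Type*} [PseudoMetricSpace E]

/-- Two monotone continuous traversals `V ∘ h₁`, `V ∘ h₂` of the same continuous arc
`V : [0, m] → E` (with `hᵢ` monotone, continuous, `hᵢ 0 = 0`, `hᵢ 1 = m`) are at
reparametrisation distance `0`. (Verbatim copy of
`Literature.Probability.RandomPlanarGeometry.Curve.reparamDist_eq_zero_of_monotone`, which is declared inside
the heavy file `Percolation/LoopRotationInvarianceAssembly.lean`; see the module docstring.) [folklore] -/
theorem reparamDist_eq_zero_of_monotone' {m : ℝ} (hm : 0 ≤ m) {V : ℝ → E}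
    (hV : ContinuousOn V (Icc 0 m)) {h₁ h₂ : ℝ → ℝ} (hc₁ : Continuous h₁) (hc₂ : Continuous h₂)
    (hmono₁ : Monotone h₁) (hmono₂ : Monotone h₂) (h₁0 : h₁ 0 = 0) (h₂0 : h₂ 0 = 0)
    (h₁1 : h₁ 1 = m) (h₂1 : h₂ 1 = m) {γ₁ γ₂ : Curve E}
    (hγ₁ : ∀ t : I, γ₁ t = V (h₁ t)) (hγ₂ : ∀ t : I, γ₂ t = V (h₂ t)) :
    reparamDist γ₁ γ₂ = 0 := by
  -- values of `hᵢ` on `I` lie in `[0, m]`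
  have hIcc : ∀ {h : ℝ → ℝ}, Monotone h → h 0 = 0 → h 1 = m → ∀ t : I, h t ∈ Icc 0 m := by
    intro h hmono h0 h1 t
    exact ⟨h0 ▸ hmono t.2.1, h1 ▸ hmono t.2.2⟩
  refine le_antisymm (le_of_forall_pos_le_add fun ε hε ↦ ?_) (reparamDist_nonneg _ _)
  rw [zero_add]
  rcases hm.eq_or_lt with rfl | hm0
  · -- degenerate arc: both curves are the constant `V 0`
    refine (reparamDist_le_dist γ₁ γ₂).trans ?_
    refine (ContinuousMap.dist_le hε.le).2 fun t ↦ ?_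
    have e1 : h₁ t = 0 := le_antisymm (hIcc hmono₁ h₁0 h₁1 t).2 (hIcc hmono₁ h₁0 h₁1 t).1
    have e2 : h₂ t = 0 := le_antisymm (hIcc hmono₂ h₂0 h₂1 t).2 (hIcc hmono₂ h₂0 h₂1 t).1
    change dist (γ₁ t) (γ₂ t) ≤ ε
    rw [hγ₁, hγ₂, e1, e2, dist_self]
    exact hε.le
  -- uniform continuity of `V` on `[0, m]`
  obtain ⟨η, hη, hU⟩ := Metric.uniformContinuousOn_iff.1
    (isCompact_Icc.uniformContinuousOn_of_continuous hV) ε hε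
  -- perturbation size
  obtain ⟨θ, hθ0, hθ1, hθη⟩ : ∃ θ : ℝ, 0 < θ ∧ θ < 1 ∧ 2 * θ * m < η := by
    refine ⟨min (1 / 2) (η / (4 * m)), by positivity, ?_, ?_⟩
    · exact (min_le_left _ _).trans_lt (by norm_num)
    · calc 2 * min (1 / 2) (η / (4 * m)) * m ≤ 2 * (η / (4 * m)) * m := by
            gcongr; exact min_le_right _ _
        _ = η / 2 := by field_simp; ring
        _ < η := by linarith
  -- strictly increasing perturbations
  set g₁ : ℝ → ℝ := fun t ↦ (1 - θ) * h₁ t + θ * m * t with hg₁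
  set g₂ : ℝ → ℝ := fun t ↦ (1 - θ) * h₂ t + θ * m * t with hg₂
  have gmono : ∀ {h : ℝ → ℝ}, Monotone h →
      StrictMono fun t ↦ (1 - θ) * h t + θ * m * t := by
    intro h hmono a b hab
    have := hmono hab.le
    have h2 : θ * m * a < θ * m * b := by gcongr
    nlinarith
  have gcont : ∀ {h : ℝ → ℝ}, Continuous h → Continuous fun t ↦ (1 - θ) * h t + θ * m * t := by
    intro h hc; fun_prop
  have g0 : ∀ {h : ℝ → ℝ}, h 0 = 0 → (1 - θ) * h 0 + θ * m * 0 = 0 := by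
    intro h h0; simp [h0]
  have g1 : ∀ {h : ℝ → ℝ}, h 1 = m → (1 - θ) * h 1 + θ * m * 1 = m := by
    intro h h1; rw [h1]; ring
  -- bundled as order isomorphisms `I ≃o Icc 0 m`
  have mkIso : ∀ {h : ℝ → ℝ}, Continuous h → Monotone h → h 0 = 0 → h 1 = m →
      ∃ Φ : I ≃o Icc (0 : ℝ) m, ∀ t : I, (Φ t : ℝ) = (1 - θ) * h t + θ * m * t := by
    intro h hc hmono h0 h1
    set g : ℝ → ℝ := fun t ↦ (1 - θ) * h t + θ * m * t
    have hg0 : g 0 = 0 := g0 h0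
    have hg1 : g 1 = m := g1 h1
    have hmaps : ∀ t : I, g t ∈ Icc (0 : ℝ) m := fun t ↦
      ⟨hg0 ▸ (gmono hmono).monotone t.2.1, hg1 ▸ (gmono hmono).monotone t.2.2⟩
    let G : I → Icc (0 : ℝ) m := fun t ↦ ⟨g t, hmaps t⟩
    have hG : StrictMono G := fun a b hab ↦ gmono hmono hab
    have hsurj : Function.Surjective G := by
      rintro ⟨s, hs⟩
      have hivt := intermediate_value_Icc zero_le_one (f := g) (gcont hc).continuousOn
      have hg0' : g 0 = 0 := hg0
      have hg1' : g 1 = m := hg1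
      simp only [hg0', hg1'] at hivt
      obtain ⟨t, ht, hts⟩ := hivt hs
      exact ⟨⟨t, ht⟩, Subtype.ext hts⟩
    exact ⟨StrictMono.orderIsoOfSurjective G hG hsurj, fun t ↦ rfl⟩
  obtain ⟨Φ₁, hΦ₁⟩ := mkIso hc₁ hmono₁ h₁0 h₁1
  obtain ⟨Φ₂, hΦ₂⟩ := mkIso hc₂ hmono₂ h₂0 h₂1
  let φ : I ≃o I := Φ₁.trans Φ₂.symm
  have hφ : ∀ t : I, (1 - θ) * h₂ (φ t) + θ * m * (φ t : I) = (1 - θ) * h₁ t + θ * m * t := by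
    intro t
    rw [← hΦ₁, ← hΦ₂]
    simp [φ]
  refine (reparamDist_le γ₁ γ₂ φ).trans ((ContinuousMap.dist_le hε.le).2 fun t ↦ ?_)
  change dist (γ₁ t) (γ₂ (φ t)) ≤ ε
  rw [hγ₁, hγ₂]
  refine (hU _ (hIcc hmono₁ h₁0 h₁1 t) _ (hIcc hmono₂ h₂0 h₂1 (φ t)) ?_).le
  -- `|h₁ t - h₂ (φ t)| ≤ 2 θ m < η`
  have b1 : ∀ {h : ℝ → ℝ}, Monotone h → h 0 = 0 → h 1 = m → ∀ s : I,
      |h s - ((1 - θ) * h s + θ * m * s)| ≤ θ * m := by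
    intro h hmono h0 h1 s
    have hs := hIcc hmono h0 h1 s
    have e : h s - ((1 - θ) * h s + θ * m * s) = θ * (h s - m * s) := by ring
    rw [e, abs_mul, abs_of_pos hθ0]
    refine mul_le_mul_of_nonneg_left (abs_le.2 ⟨?_, ?_⟩) hθ0.le
    · have : m * (s : ℝ) ≤ m * 1 := by gcongr; exact s.2.2
      linarith [hs.1]
    · have : 0 ≤ m * (s : ℝ) := by have := s.2.1; positivity
      linarith [hs.2]
  rw [Real.dist_eq]
  calc |h₁ t - h₂ (φ t)|
      = |(h₁ t - ((1 - θ) * h₁ t + θ * m * t)) -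
          (h₂ (φ t) - ((1 - θ) * h₂ (φ t) + θ * m * (φ t : I)))| := by rw [hφ]; ring_nf
    _ ≤ |h₁ t - ((1 - θ) * h₁ t + θ * m * t)| +
          |h₂ (φ t) - ((1 - θ) * h₂ (φ t) + θ * m * (φ t : I))| := abs_sub _ _
    _ ≤ θ * m + θ * m := add_le_add (b1 hmono₁ h₁0 h₁1 t) (b1 hmono₂ h₂0 h₂1 (φ t))
    _ = 2 * θ * m := by ring
    _ < η := hθη


end Curve

end Literature.Probability.RandomPlanarGeometry
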